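import Literature.Topology.FourManifolds.TorusCoordinates
import Literature.Topology.FourManifolds.KnotFraming
import Mathlib.Analysis.SpecialFunctions.SmoothTransition
import Mathlib.Analysis.InnerProductSpace.Calculus
import HarnessLib

/-!
# Disc extension, layer 0': angle functions on the punctured plane

Auxiliary file of helper `helper_sliceGluing_discExtension` (apex leaf DX: extension of the
torus angular coordinate over the torus disc), line `Sketch`, crux `SblfDescent.RungOne`.

(Crux item stmt-SmoothPoincare4-18531; skeleton `Cruxes/RungOne/Lines/Sketch.lean`.)

Bookkeeping for functions on the punctured plane `ℝ² ∖ 0` written in polar form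
`w ↦ F(‖w‖, t)` with `F` one-periodic in the angle variable `t = (angle of w) / 2π`:

* `angW`, `angW'` — the two real-analytic branches `1/2 + arg(-w)/2π ∈ (0, 1]` and
  `1 + arg(w)/2π ∈ (1/2, 3/2]` of the angle (they extend the tree's `angA`, `angB` of
  `TorusCoordinates.lean` from the unit circle to the punctured plane), smooth off the positive,
  resp. negative, real half-axis, differing by an integer, with `‖w‖ • circlePt (angW w) = w`;
* `contMDiffAt_polar_of_periodic` — if `F p r t` is smooth and `1`-periodic in `t` then
  `(p, w) ↦ F p ‖w‖ (angW w)` is smooth at every `w ≠ 0`;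
Everything is folklore calculus.
-/

set_option linter.dupNamespace false

noncomputable section

open scoped Manifold ContDiff Topology Real
open Set Function Metric Complex Literature.Topology.FourManifolds

namespace Summit.SmoothPoincare4.SmoothPoincare4.Cruxes.RungOne.Sketch

namespace DiscExt

/-- Local notation: `𝔼 n` is the model Euclidean space `EuclideanSpace ℝ (Fin n)`. -/
local notation "𝔼 " n:arg => EuclideanSpace ℝ (Fin n)

/-- Local notation: `𝕊¹`, the unit circle of `ℝ²`. -/
local notation "𝕊¹" => (Metric.sphere (0 : EuclideanSpace ℝ (Fin 2)) (1 : ℝ))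

/-! ### One-periodic functions -/

/-- A `1`-periodic function is invariant under integer shifts. [folklore] -/
theorem periodic_int_shift {α : Type*} {F : ℝ → α} (hper : ∀ t, F (t + 1) = F t) (t : ℝ) (m : ℤ) :
    F (t + m) = F t := by
  induction m using Int.induction_on with
  | zero => simp
  | succ n ih => rw [Int.cast_add, Int.cast_one, ← add_assoc, hper, ih]
  | pred n ih =>
    rw [← ih, Int.cast_sub, Int.cast_one, ← hper (t + ((-(n : ℤ) : ℤ) - 1 : ℝ))]
    congr 1; ring

/-- A `1`-periodic function takes equal values at arguments with the same `circlePt`. [folklore] -/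
theorem periodic_eq_of_circlePt_eq {α : Type*} {F : ℝ → α} (hper : ∀ t, F (t + 1) = F t) {a b : ℝ}
    (h : circlePt a = circlePt b) : F a = F b := by
  obtain ⟨m, rfl⟩ := circlePt_eq_circlePt_iff.1 h
  exact periodic_int_shift hper b m

/-! ### The two angle branches on the punctured plane -/

/-- **First angle branch** `angW w = 1/2 + arg(-(w₀ + i w₁)) / 2π ∈ (0, 1]`; on the unit circle
this is the tree's `angA`. [folklore] -/
def angW (w : 𝔼 2) : ℝ := 1 / 2 + arg (-toC w) / (2 * π)

/-- **Second angle branch** `angW' w = 1 + arg(w₀ + i w₁) / 2π ∈ (1/2, 3/2]`; on the unit circle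
this is the tree's `angB`. [folklore] -/
def angW' (w : 𝔼 2) : ℝ := 1 + arg (toC w) / (2 * π)

/-- On the unit circle, `angW = angA`. [folklore] -/
theorem angW_coe (u : 𝕊¹) : angW (u : 𝔼 2) = angA u := rfl

/-- `angW` is invariant under positive dilations. [folklore] -/
theorem angW_smul {c : ℝ} (hc : 0 < c) (w : 𝔼 2) : angW (c • w) = angW w := by
  have h : toC (c • w) = (c : ℂ) * toC w := by apply Complex.ext <;> simp [toC]
  rw [angW, angW, h, ← mul_neg, Complex.arg_real_mul _ hc]

/-- **`angW` is smooth off the closed positive real half-axis.** [folklore] -/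
theorem contDiffAt_angW {w : 𝔼 2} (hw : w 0 < 0 ∨ w 1 ≠ 0) : ContDiffAt ℝ ∞ angW w := by
  have hslit : -toC w ∈ slitPlane := by
    rw [mem_slitPlane_iff, neg_re, neg_im, toC_re, toC_im]
    rcases hw with h | h
    · exact Or.inl (by linarith)
    · exact Or.inr (neg_ne_zero.2 h)
  have hg : ContDiffAt ℝ ∞ (fun z : ℂ ↦ 1 / 2 + arg z / (2 * π)) (-toC w) :=
    contDiffAt_const.add ((contDiffAt_arg hslit).div_const _)
  have he : angW = (fun z : ℂ ↦ 1 / 2 + arg z / (2 * π)) ∘ fun w ↦ -toC w := rfl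
  rw [he]
  exact hg.comp w contDiff_toC.neg.contDiffAt

/-- **`angW'` is smooth off the closed negative real half-axis.** [folklore] -/
theorem contDiffAt_angW' {w : 𝔼 2} (hw : 0 < w 0 ∨ w 1 ≠ 0) : ContDiffAt ℝ ∞ angW' w := by
  have hslit : toC w ∈ slitPlane := by
    rw [mem_slitPlane_iff, toC_re, toC_im]
    exact hw
  have hg : ContDiffAt ℝ ∞ (fun z : ℂ ↦ 1 + arg z / (2 * π)) (toC w) :=
    contDiffAt_const.add ((contDiffAt_arg hslit).div_const _)
  have he : angW' = (fun z : ℂ ↦ 1 + arg z / (2 * π)) ∘ toC := rfl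
  rw [he]
  exact hg.comp w contDiff_toC.contDiffAt

/-- **The two branches differ by an integer**: `angW' = angW` or `angW' = angW + 1` at every
`w ≠ 0`. [folklore] -/
theorem angW'_eq_or {w : 𝔼 2} (hw : w ≠ 0) : angW' w = angW w ∨ angW' w = angW w + 1 := by
  have hπ : 0 < π := Real.pi_pos
  have hz : toC w ≠ 0 := fun h ↦ hw (norm_eq_zero.1 (by rw [← norm_toC, h, norm_zero]))
  rcases lt_trichotomy (toC w).im 0 with him | him | him
  · left
    rw [angW', angW, arg_neg_eq_arg_add_pi_of_im_neg him]
    field_simp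
    ring
  · -- `toC w` is a nonzero real number
    rcases lt_or_gt_of_ne (show (toC w).re ≠ 0 from fun h ↦ hz (Complex.ext h him)) with hre | hre
    · right
      have h1 : arg (toC w) = π := (arg_eq_pi_iff.2 ⟨hre, him⟩)
      have h2 : arg (-toC w) = 0 := arg_eq_zero_iff.2 ⟨by rw [neg_re]; linarith, by rw [neg_im, him, neg_zero]⟩
      rw [angW', angW, h1, h2]
      field_simp
      ring
    · left
      have h1 : arg (toC w) = 0 := arg_eq_zero_iff.2 ⟨hre.le, him⟩
      have h2 : arg (-toC w) = π := arg_eq_pi_iff.2 ⟨by rw [neg_re]; linarith, by rw [neg_im, him, neg_zero]⟩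
      rw [angW', angW, h1, h2]
      field_simp
      ring
  · right
    rw [angW', angW, arg_neg_eq_arg_sub_pi_of_im_pos him]
    field_simp
    ring

/-- A `1`-periodic function takes the same value on the two angle branches. [folklore] -/
theorem periodic_angW'_eq {α : Type*} {F : ℝ → α} (hper : ∀ t, F (t + 1) = F t) {w : 𝔼 2}
    (hw : w ≠ 0) : F (angW' w) = F (angW w) := by
  rcases angW'_eq_or hw with h | h
  · rw [h]
  · rw [h, hper]

/-- **Polar reconstruction**: `circlePt (angW w) = w / ‖w‖` for `w ≠ 0`. [folklore] -/
theorem coe_circlePt_angW {w : 𝔼 2} (hw : w ≠ 0) :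
    ((circlePt (angW w) : 𝕊¹) : 𝔼 2) = ‖w‖⁻¹ • w := by
  have hz : toC w ≠ 0 := fun h ↦ hw (norm_eq_zero.1 (by rw [← norm_toC, h, norm_zero]))
  have hsm : toC (‖w‖⁻¹ • w) = ((‖w‖⁻¹ : ℝ) : ℂ) * toC w := by apply Complex.ext <;> simp [toC]
  apply toC_injective
  rw [toC_circlePt, hsm, Circle.coe_exp, angW]
  have h1 : ((2 * π * (1 / 2 + arg (-toC w) / (2 * π)) : ℝ) : ℂ) * I =
      π * I + arg (-toC w) * I := by
    have hπ : (π : ℝ) ≠ 0 := Real.pi_pos.ne'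
    push_cast
    field_simp
  rw [h1, Complex.exp_add, exp_pi_mul_I]
  have h2 := norm_mul_exp_arg_mul_I (-toC w)
  rw [norm_neg] at h2
  -- `exp (arg(-z) i) = -z / ‖z‖`
  have hn : (‖toC w‖ : ℂ) ≠ 0 := by exact_mod_cast (norm_ne_zero_iff.2 hz)
  have h3 : Complex.exp (arg (-toC w) * I) = -toC w / ‖toC w‖ := by
    rw [eq_div_iff hn, mul_comm]; exact h2
  rw [h3, norm_toC]
  push_cast
  field_simp

/-- `‖w‖ • circlePt (angW w) = w` for `w ≠ 0`. [folklore] -/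
theorem norm_smul_circlePt_angW {w : 𝔼 2} (hw : w ≠ 0) :
    ‖w‖ • ((circlePt (angW w) : 𝕊¹) : 𝔼 2) = w := by
  rw [coe_circlePt_angW hw, smul_smul, mul_inv_cancel₀ (norm_ne_zero_iff.2 hw), one_smul]

/-- The circle of radius `R > 0`: `‖R • circlePt t‖ = R`. [folklore] -/
theorem norm_smul_circlePt {R : ℝ} (hR : 0 ≤ R) (t : ℝ) :
    ‖R • ((circlePt t : 𝕊¹) : 𝔼 2)‖ = R := by
  rw [norm_smul, norm_eq_of_mem_sphere (circlePt t), mul_one, Real.norm_eq_abs, abs_of_nonneg hR]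

/-- `R • circlePt t ≠ 0` for `R > 0`. [folklore] -/
theorem smul_circlePt_ne_zero {R : ℝ} (hR : 0 < R) (t : ℝ) :
    R • ((circlePt t : 𝕊¹) : 𝔼 2) ≠ 0 := by
  rw [← norm_ne_zero_iff, norm_smul_circlePt hR.le]; exact hR.ne'

/-- **The angle of `R • circlePt t` is `t` modulo `ℤ`.** [folklore] -/
theorem circlePt_angW_smul_circlePt {R : ℝ} (hR : 0 < R) (t : ℝ) :
    circlePt (angW (R • ((circlePt t : 𝕊¹) : 𝔼 2))) = circlePt t := by
  rw [angW_smul hR, angW_coe, circlePt_angA]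

/-- A `1`-periodic function of the angle, evaluated on the circle `t ↦ R • circlePt t`, is the
function itself. [folklore] -/
theorem periodic_angW_smul_circlePt {α : Type*} {F : ℝ → α} (hper : ∀ t, F (t + 1) = F t)
    {R : ℝ} (hR : 0 < R) (t : ℝ) : F (angW (R • ((circlePt t : 𝕊¹) : 𝔼 2))) = F t :=
  periodic_eq_of_circlePt_eq hper (circlePt_angW_smul_circlePt hR t)

/-! ### Smoothness in polar form -/

section Polar

variable {EN : Type*} [NormedAddCommGroup EN] [NormedSpace ℝ EN] {HN : Type*} [TopologicalSpace HN]
  {I : ModelWithCorners ℝ EN HN} {N : Type*} [TopologicalSpace N] [ChartedSpace HN N]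
  {EM : Type*} [NormedAddCommGroup EM] [NormedSpace ℝ EM] {HM : Type*} [TopologicalSpace HM]
  {J : ModelWithCorners ℝ EM HM} {M : Type*} [TopologicalSpace M] [ChartedSpace HM M]

/-- The polar map `(p, w) ↦ (p, ‖w‖, angW w)` is smooth off the positive half-axis. [folklore] -/
theorem contMDiffAt_polarA (p : N) {w : 𝔼 2} (hw : w 0 < 0 ∨ w 1 ≠ 0) :
    ContMDiffAt (I.prod 𝓘(ℝ, 𝔼 2)) (I.prod (𝓘(ℝ, ℝ).prod 𝓘(ℝ, ℝ))) ∞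
      (fun q : N × 𝔼 2 ↦ (q.1, ‖q.2‖, angW q.2)) (p, w) := by
  have hw0 : w ≠ 0 := by
    rintro rfl
    simp at hw
  have h1 : ContMDiffAt 𝓘(ℝ, 𝔼 2) 𝓘(ℝ, ℝ) ∞ (fun w : 𝔼 2 ↦ ‖w‖) w :=
    (contDiffAt_norm ℝ hw0).contMDiffAt
  have h2 : ContMDiffAt 𝓘(ℝ, 𝔼 2) 𝓘(ℝ, ℝ) ∞ angW w := (contDiffAt_angW hw).contMDiffAt
  have h1' : ContMDiffAt (I.prod 𝓘(ℝ, 𝔼 2)) 𝓘(ℝ, ℝ) ∞ (fun q : N × 𝔼 2 ↦ ‖q.2‖) (p, w) :=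
    ContMDiffAt.comp (I' := 𝓘(ℝ, 𝔼 2)) (f := Prod.snd) (p, w) h1 contMDiffAt_snd
  have h2' : ContMDiffAt (I.prod 𝓘(ℝ, 𝔼 2)) 𝓘(ℝ, ℝ) ∞ (fun q : N × 𝔼 2 ↦ angW q.2) (p, w) :=
    ContMDiffAt.comp (I' := 𝓘(ℝ, 𝔼 2)) (f := Prod.snd) (p, w) h2 contMDiffAt_snd
  exact contMDiffAt_fst.prodMk (h1'.prodMk h2')

/-- The polar map `(p, w) ↦ (p, ‖w‖, angW' w)` is smooth off the negative half-axis. [folklore] -/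
theorem contMDiffAt_polarB (p : N) {w : 𝔼 2} (hw : 0 < w 0 ∨ w 1 ≠ 0) :
    ContMDiffAt (I.prod 𝓘(ℝ, 𝔼 2)) (I.prod (𝓘(ℝ, ℝ).prod 𝓘(ℝ, ℝ))) ∞
      (fun q : N × 𝔼 2 ↦ (q.1, ‖q.2‖, angW' q.2)) (p, w) := by
  have hw0 : w ≠ 0 := by
    rintro rfl
    simp at hw
  have h1 : ContMDiffAt 𝓘(ℝ, 𝔼 2) 𝓘(ℝ, ℝ) ∞ (fun w : 𝔼 2 ↦ ‖w‖) w :=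
    (contDiffAt_norm ℝ hw0).contMDiffAt
  have h2 : ContMDiffAt 𝓘(ℝ, 𝔼 2) 𝓘(ℝ, ℝ) ∞ angW' w := (contDiffAt_angW' hw).contMDiffAt
  have h1' : ContMDiffAt (I.prod 𝓘(ℝ, 𝔼 2)) 𝓘(ℝ, ℝ) ∞ (fun q : N × 𝔼 2 ↦ ‖q.2‖) (p, w) :=
    ContMDiffAt.comp (I' := 𝓘(ℝ, 𝔼 2)) (f := Prod.snd) (p, w) h1 contMDiffAt_snd
  have h2' : ContMDiffAt (I.prod 𝓘(ℝ, 𝔼 2)) 𝓘(ℝ, ℝ) ∞ (fun q : N × 𝔼 2 ↦ angW' q.2) (p, w) :=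
    ContMDiffAt.comp (I' := 𝓘(ℝ, 𝔼 2)) (f := Prod.snd) (p, w) h2 contMDiffAt_snd
  exact contMDiffAt_fst.prodMk (h1'.prodMk h2')

/-- **Smoothness in polar form.** Let `F p r t` be jointly smooth at the points `(p, ‖w‖, t)`
and `1`-periodic in `t`. Then `(p, w) ↦ F p ‖w‖ (angW w)` is smooth at `(p, w)` for `w ≠ 0`
(near the positive half-axis one switches to the branch `angW'`, on which the function takes
the same values). [folklore] -/
theorem contMDiffAt_polar_of_periodic {F : N → ℝ → ℝ → M} (p : N) {w : 𝔼 2} (hw : w ≠ 0)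
    (hF : ∀ t, ContMDiffAt (I.prod (𝓘(ℝ, ℝ).prod 𝓘(ℝ, ℝ))) J ∞
      (fun q : N × ℝ × ℝ ↦ F q.1 q.2.1 q.2.2) (p, ‖w‖, t))
    (hper : ∀ p r t, F p r (t + 1) = F p r t) :
    ContMDiffAt (I.prod 𝓘(ℝ, 𝔼 2)) J ∞ (fun q : N × 𝔼 2 ↦ F q.1 ‖q.2‖ (angW q.2)) (p, w) := by
  by_cases hA : w 0 < 0 ∨ w 1 ≠ 0
  · exact (hF (angW w)).comp (p, w) (contMDiffAt_polarA p hA)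
  · have hB : 0 < w 0 ∨ w 1 ≠ 0 := by
      push Not at hA
      refine Or.inl (lt_of_le_of_ne hA.1 fun h0 ↦ hw ?_)
      ext i; fin_cases i
      · simpa using h0.symm
      · simpa using hA.2
    have hev : (fun q : N × 𝔼 2 ↦ F q.1 ‖q.2‖ (angW q.2)) =ᶠ[𝓝 (p, w)]
        fun q : N × 𝔼 2 ↦ F q.1 ‖q.2‖ (angW' q.2) := by
      have ho : IsOpen {q : N × 𝔼 2 | q.2 ≠ 0} := isOpen_ne.preimage continuous_snd
      filter_upwards [ho.mem_nhds (show (p, w) ∈ {q : N × 𝔼 2 | q.2 ≠ 0} from hw)] with q hq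
      exact (periodic_angW'_eq (hper q.1 ‖q.2‖) hq).symm
    refine ContMDiffAt.congr_of_eventuallyEq ?_ hev
    exact (hF (angW' w)).comp (p, w) (contMDiffAt_polarB p hB)

end Polar

end DiscExt

end Summit.SmoothPoincare4.SmoothPoincare4.Cruxes.RungOne.Sketch

end
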